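import Literature.MathematicalPhysics.QuantumFieldTheory.Balaban1983to89.B2Eq324NestedRegions

/-!
# `Balaban1983to89.B2Eq36ScaleDecomposition` — [Balaban1982Higgs2] (3.6) p. 584: the scale decomposition of the
level-`k` torus `T₁⁽ᵏ⁾ = Λ₅⁽ᵏ⁾ᶜ ∪ ⋃_{l=k+1}^{K−1} B^{l−k}(Λ₅⁽ˡ⁻¹⁾′ ∩ Λ₅⁽ˡ⁾ᶜ) ∪ B^{K−1−k}(Λ₅⁽ᴷ⁻¹⁾)`, PROVED at every level
`k ≤ K − 1` for the tower of large-field regions `B2Eq324NestedRegions.Tower` (a disjoint union)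

statement-level skeleton of published theorems with citation tags; proofs where landed; nothing here is a claim about the Yang–Mills mass gap

CITATION HEADER.  T. Bałaban, *(Higgs)₂,₃ quantum fields in a finite volume. II. An upper bound*, Commun. Math. Phys. **86**
(1982) 555–594 [Balaban1982Higgs2] (PDF held `paper:balaban1982-cmp86-higgs23-ii`, journal page = PDF page + 554; p. 584
[PDF 30] READ AS IMAGE on the ×2 render
`run/shared/lean/pub/pub-balaban/b2b-balaban-ref1/pages/1982-cmp86-higgs23-II/1982-cmp86-higgs23-II-p030-x2.png`, display (3.6)
cropped and re-read; p. 588 [PDF 34] for the tower).  Cell `lit-balaban` (HOME `run/shared/lean/pub/lit-balaban/`), reader/typer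
seat **r02** gen 9 (unit `lit-balaban-r02-g9`, owner of ROWS-B2); SKELETON row **B2.Eq3.1-3.10** (§3.A (3.1)–(3.10), born
ROWS-B2 v2.54), member (3.6).

WHAT IS PRINTED (p. 584 [PDF 30], verbatim, after the inductive hypothesis (3.5)): *"The expression on the right side seems to
be rather complicated, however it has a simple structure. Here T₁⁽ᵏ⁾ can be represented as a sum*
  `T₁⁽ᵏ⁾ = Λ₅⁽ᵏ⁾ᶜ ∪ ⋃_{l=k+1}^{K−1} B^{l−k}(Λ₅⁽ˡ⁻¹⁾′ ∩ Λ₅⁽ˡ⁾ᶜ) ∪ B^{K−1−k}(Λ₅⁽ᴷ⁻¹⁾),   (3.6)`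
*and to each set Λ₅⁽ˡ⁻¹⁾′ ∩ Λ₅⁽ˡ⁾ᶜ there corresponds a set of characteristic functions and a sequence of partial renormalization
transformations localized in this set."*  Here `T₁⁽ᵏ⁾` is the unit lattice after `k` steps (the `Lᵏε`-lattice `T⁽ᵏ⁾` rescaled,
p. 583: the fields `A_k, φ_k` live on it), `Λ₅⁽ˡ⁾ ⊂ T⁽ˡ⁾` the step-`l` regions of (2.7)–(2.8) (unions of blocks), `Λ′` the set
`Λ ⊂ T⁽ˡ⁻¹⁾` read on the next lattice `T⁽ˡ⁾` (the coarse sites whose block lies in `Λ`), `Bʲ(·)` the `j`-fold block operation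
(part I (1.18)–(1.20)), and p. 588 [PDF 34]: *"where Λ₅⁽ᴷ⁾ = ∅."*

READING / CONSISTENCY NOTE (r02).  The last set of (3.6) is printed WITHOUT a prime, `B^{K−1−k}(Λ₅⁽ᴷ⁻¹⁾)` with
`Λ₅⁽ᴷ⁻¹⁾ ⊂ T⁽ᴷ⁻¹⁾`, and this is consistent: since `Λ₅⁽ᴷ⁾ = ∅` and `Λ₅⁽ᴷ⁻¹⁾` is a union of blocks, the would-be `l = K` term
`B^{K−k}(Λ₅⁽ᴷ⁻¹⁾′ ∩ Λ₅⁽ᴷ⁾ᶜ) = B^{K−k}(Λ₅⁽ᴷ⁻¹⁾′) = B^{K−1−k}(Λ₅⁽ᴷ⁻¹⁾)` (`core_eq_ann_top` below).  The union in (3.6) is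
DISJOINT (the print says "sum"); we prove both the covering identity and the pairwise disjointness.

DICTIONARY (print ↦ Lean; carrier = the concrete `HiggsLattice` tori `Site P k = T⁽ᵏ⁾` of part I with the corner-anchored
block map `HiggsLattice.blockOf : T⁽ᵏ⁾ → T⁽ᵏ⁺¹⁾`).  The tower `Λ₅⁽⁰⁾, …, Λ₅⁽ᴷ⁾ = ∅` ↦ `T : B2Eq324NestedRegions.Tower P K`
(p15: `T.lam l = Λ₅⁽ˡ⁾`, `T.top`, `T.isUnion`, `T.nested`); `x_{k+j}` (the `j`-fold block point of `x ∈ T⁽ᵏ⁾`) ↦ `blockUp k j x`;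
`Bʲ(Λ)` for `Λ ⊂ T⁽ᵏ⁺ʲ⁾` ↦ `blockSetUp k j Λ ⊂ T⁽ᵏ⁾`; `Λ′` ↦ p15's `B2Eq324NestedRegions.prime Λ`; the annulus
`B^{l−k}(Λ₅⁽ˡ⁻¹⁾′ ∩ Λ₅⁽ˡ⁾ᶜ)`, `l = k + j + 1`, ↦ `ann T k j`; the core `B^{K−1−k}(Λ₅⁽ᴷ⁻¹⁾)` ↦ `core T k n` with
`k + n + 1 = K` (so `k + n = K − 1`; the level arithmetic is carried by `n` to keep the dependent types `Site P (k + j)` free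
of truncated subtraction).

WHAT THIS MODULE PROVES (kernel-checked, 0 `sorry`, standard axioms): `mem_ann_iff` (`x ∈ B^{j+1}(Λ₅⁽ᵏ⁺ʲ⁾′ ∩ Λ₅⁽ᵏ⁺ʲ⁺¹⁾ᶜ)`
iff `x_{k+j} ∈ Λ₅⁽ᵏ⁺ʲ⁾` and `x_{k+j+1} ∉ Λ₅⁽ᵏ⁺ʲ⁺¹⁾`), the covering **`eq36`**
(`T⁽ᵏ⁾ = Λ₅⁽ᵏ⁾ᶜ ∪ ⋃_{j<n} ann j ∪ core`, `k + n + 1 = K`), the disjointness `disjoint_compl_ann`, `disjoint_compl_core`,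
`disjoint_ann_ann`, `disjoint_ann_core`, the cardinality form `card_eq36`, and `core_eq_ann_top`.  At `k = 0` the content
is p15's `B2Eq324NestedRegions.Tower.nested_regions` (`Λ₅⁽⁰⁾ = ⨆_{l=1}^{K} Bˡ(Λ_l)`, `Λ_l = Λ₅⁽ˡ⁻¹⁾′ ∩ Λ₅⁽ˡ⁾ᶜ`), there phrased
with `HiggsAveraging.blockIter` from level `0`; this file re-does the elementary descent argument from an arbitrary level `k`.

HONEST SCOPE.  Set bookkeeping only: the construction (2.7)–(2.8) of the regions from field configurations and the
"characteristic functions and partial renormalization transformations localized in" the annuli ((3.5), (3.7)) are NOT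
formalized here.  value = one located identity of row B2.Eq3.1-3.10 as a kernel theorem on the concrete tower — NOT summit
progress.
-/

noncomputable section

open Finset

namespace Literature.MathematicalPhysics.QuantumFieldTheory.Balaban1983to89.B2Eq36ScaleDecomposition

open Literature.MathematicalPhysics.QuantumFieldTheory.Balaban1983to89.HiggsLattice
open Literature.MathematicalPhysics.QuantumFieldTheory.Balaban1983to89.B2Eq324NestedRegions

variable {P : HiggsLattice.Params} {K : ℕ}

/-! ## §1 Iterated blocks from level `k`: `x ↦ x_{k+j}` and `Bʲ(Λ)` -/

/-- `x_{k+j} ∈ T⁽ᵏ⁺ʲ⁾`: the `j`-fold block point of a site `x ∈ T⁽ᵏ⁾` (`x ∈ Bʲ(x_{k+j})`; part I p. 608 *"x_j ∈ B(x_{j+1})"*,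
here started at level `k` instead of `0`). [cite: Balaban1982Higgs1, (1.20) p.607] -/
def blockUp (k : ℕ) : (j : ℕ) → HiggsLattice.Site P k → HiggsLattice.Site P (k + j)
  | 0, x => x
  | j + 1, x => HiggsLattice.blockOf (blockUp k j x)

/-- `x_{k+0} = x`. [cite: Balaban1982Higgs1, (1.20) p.607] -/
theorem blockUp_zero (k : ℕ) (x : HiggsLattice.Site P k) : blockUp k 0 x = x := rfl

/-- `x_{k+j+1} = (x_{k+j})₁` (one more block step). [cite: Balaban1982Higgs1, (1.20) p.607] -/
theorem blockUp_succ (k j : ℕ) (x : HiggsLattice.Site P k) :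
    blockUp k (j + 1) x = HiggsLattice.blockOf (blockUp k j x) := rfl

/-- `Bʲ(Λ) ⊂ T⁽ᵏ⁾` for `Λ ⊂ T⁽ᵏ⁺ʲ⁾`: the sites whose `j`-fold block point lies in `Λ` ((1.18)–(1.20) of part I, from level
`k`). [cite: Balaban1982Higgs1, (1.18) p.607] -/
def blockSetUp (k j : ℕ) (Λ : Finset (HiggsLattice.Site P (k + j))) : Finset (HiggsLattice.Site P k) :=
  univ.filter fun x => blockUp k j x ∈ Λ

/-- `x ∈ Bʲ(Λ)` iff `x_{k+j} ∈ Λ`. [cite: Balaban1982Higgs1, (1.18) p.607] -/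
theorem mem_blockSetUp (k j : ℕ) (Λ : Finset (HiggsLattice.Site P (k + j))) (x : HiggsLattice.Site P k) :
    x ∈ blockSetUp k j Λ ↔ blockUp k j x ∈ Λ := by
  simp [blockSetUp]

/-- `B⁰(Λ) = Λ`. [cite: Balaban1982Higgs1, (1.18) p.607] -/
theorem blockSetUp_zero (k : ℕ) (Λ : Finset (HiggsLattice.Site P k)) : blockSetUp k 0 Λ = Λ := by
  ext x; simp [blockSetUp, blockUp]

/-- `B¹(Λ) = B(Λ)` (the tree's one-step `HiggsLattice.blockSet`). [cite: Balaban1982Higgs1, (1.18) p.607] -/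
theorem blockSetUp_one (k : ℕ) (Λ : Finset (HiggsLattice.Site P (k + 1))) :
    blockSetUp k 1 Λ = HiggsLattice.blockSet Λ := by
  ext x; simp [blockSetUp, blockUp, HiggsLattice.mem_blockSet]

/-! ## §2 The pieces of (3.6) for a tower of large-field regions -/

variable (T : Tower P K)

/-- `x_{k+j} ∈ Λ₅⁽ᵏ⁺ʲ⁾`: the `j`-fold block point of `x ∈ T⁽ᵏ⁾` lies in the step-`(k+j)` region.
[cite: Balaban1982Higgs2, (3.6) p.584] -/
def lamUp (k j : ℕ) (x : HiggsLattice.Site P k) : Prop := blockUp k j x ∈ T.lam (k + j)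

/-- At `j = 0`: `x ∈ Λ₅⁽ᵏ⁾`. [cite: Balaban1982Higgs2, (3.6) p.584] -/
theorem lamUp_zero (k : ℕ) (x : HiggsLattice.Site P k) : lamUp T k 0 x ↔ x ∈ T.lam k := Iff.rfl

/-- One step of monotonicity (nesting `B(Λ₅⁽ᵐ⁺¹⁾) ⊂ Λ₅⁽ᵐ⁾`): `x_{k+j+1} ∈ Λ₅⁽ᵏ⁺ʲ⁺¹⁾ ⇒ x_{k+j} ∈ Λ₅⁽ᵏ⁺ʲ⁾`.
[cite: Balaban1982Higgs2, (3.22) p.588] -/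
theorem lamUp_succ_imp {k j : ℕ} (hj : k + j < K) (x : HiggsLattice.Site P k) :
    lamUp T k (j + 1) x → lamUp T k j x :=
  T.nested (k + j) hj (blockUp k j x)

/-- Monotonicity along the tower from level `k`: `x_{k+j} ∈ Λ₅⁽ᵏ⁺ʲ⁾ ⇒ x_{k+i} ∈ Λ₅⁽ᵏ⁺ⁱ⁾` for `i ≤ j`, `k + j ≤ K`.
[cite: Balaban1982Higgs2, (3.22) p.588] -/
theorem lamUp_anti {k i j : ℕ} (hij : i ≤ j) (hj : k + j ≤ K) (x : HiggsLattice.Site P k) :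
    lamUp T k j x → lamUp T k i x := by
  induction j, hij using Nat.le_induction with
  | base => exact id
  | succ j hij ih => exact fun h => ih (by omega) (lamUp_succ_imp T (by omega) x h)

/-- At the top `k + j = K`: never (`Λ₅⁽ᴷ⁾ = ∅`, p. 588). [cite: Balaban1982Higgs2, (3.23) p.588] -/
theorem not_lamUp_top {k j : ℕ} (h : k + j = K) (x : HiggsLattice.Site P k) : ¬ lamUp T k j x := by
  unfold lamUp
  subst h
  rw [T.top]
  exact Finset.notMem_empty _

/-- **The annulus of (3.6)** with `l = k + j + 1 ∈ {k+1, …, K−1}`: `B^{l−k}(Λ₅⁽ˡ⁻¹⁾′ ∩ Λ₅⁽ˡ⁾ᶜ) = B^{j+1}(Λ₅⁽ᵏ⁺ʲ⁾′ ∖ Λ₅⁽ᵏ⁺ʲ⁺¹⁾)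
⊂ T⁽ᵏ⁾`, AS PRINTED (`Λ′` = p15's `prime`). [cite: Balaban1982Higgs2, (3.6) p.584] -/
def ann (k j : ℕ) : Finset (HiggsLattice.Site P k) :=
  blockSetUp k (j + 1) (prime (T.lam (k + j)) \ T.lam (k + j + 1))

/-- **The core of (3.6)**: `Bⁿ(Λ₅⁽ᵏ⁺ⁿ⁾) ⊂ T⁽ᵏ⁾` (in the print `n = K − 1 − k`, the set `B^{K−1−k}(Λ₅⁽ᴷ⁻¹⁾)`, unprimed).
[cite: Balaban1982Higgs2, (3.6) p.584] -/
def core (k n : ℕ) : Finset (HiggsLattice.Site P k) :=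
  blockSetUp k n (T.lam (k + n))

/-- Membership in the annulus: `x ∈ B^{j+1}(Λ₅⁽ᵏ⁺ʲ⁾′ ∩ Λ₅⁽ᵏ⁺ʲ⁺¹⁾ᶜ)` iff `x_{k+j} ∈ Λ₅⁽ᵏ⁺ʲ⁾` and `x_{k+j+1} ∉ Λ₅⁽ᵏ⁺ʲ⁺¹⁾`
(uses that `Λ₅⁽ᵏ⁺ʲ⁾` is a union of blocks, `k + j < K`). [cite: Balaban1982Higgs2, (3.6) p.584] -/
theorem mem_ann_iff {k j : ℕ} (hj : k + j < K) (x : HiggsLattice.Site P k) :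
    x ∈ ann T k j ↔ lamUp T k j x ∧ ¬ lamUp T k (j + 1) x := by
  rw [ann, mem_blockSetUp, Finset.mem_sdiff, mem_prime]
  refine and_congr ⟨fun h => h _ rfl, fun h x' hx' => ?_⟩ Iff.rfl
  exact (T.isUnion (k + j) hj x' (blockUp k j x) hx').mpr h

/-- Membership in the core: `x ∈ Bⁿ(Λ₅⁽ᵏ⁺ⁿ⁾)` iff `x_{k+n} ∈ Λ₅⁽ᵏ⁺ⁿ⁾`. [cite: Balaban1982Higgs2, (3.6) p.584] -/
theorem mem_core_iff (k n : ℕ) (x : HiggsLattice.Site P k) : x ∈ core T k n ↔ lamUp T k n x :=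
  mem_blockSetUp k n _ x

/-- **The unprimed last set of (3.6) is the `l = K` annulus**: `B^{K−1−k}(Λ₅⁽ᴷ⁻¹⁾) = B^{K−k}(Λ₅⁽ᴷ⁻¹⁾′ ∩ Λ₅⁽ᴷ⁾ᶜ)` since
`Λ₅⁽ᴷ⁾ = ∅` and `Λ₅⁽ᴷ⁻¹⁾` is a union of blocks (`k + n + 1 = K`). [cite: Balaban1982Higgs2, (3.6) p.584] -/
theorem core_eq_ann_top {k n : ℕ} (hK : k + n + 1 = K) : core T k n = ann T k n := by
  ext x
  rw [mem_core_iff, mem_ann_iff T (by omega)]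
  exact ⟨fun h => ⟨h, not_lamUp_top T (by omega) x⟩, fun h => h.1⟩

/-! ## §3 (3.6): `T₁⁽ᵏ⁾ = Λ₅⁽ᵏ⁾ᶜ ∪ ⋃_{l=k+1}^{K−1} B^{l−k}(Λ₅⁽ˡ⁻¹⁾′ ∩ Λ₅⁽ˡ⁾ᶜ) ∪ B^{K−1−k}(Λ₅⁽ᴷ⁻¹⁾)`, a disjoint union -/

/-- Every site of `T⁽ᵏ⁾` lies in `Λ₅⁽ᵏ⁾ᶜ`, or in one of the annuli `l = k+1, …, K−1`, or in the core (first descent of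
`j ↦ [x_{k+j} ∈ Λ₅⁽ᵏ⁺ʲ⁾]`). [cite: Balaban1982Higgs2, (3.6) p.584] -/
theorem eq36_cover {k n : ℕ} (hK : k + n + 1 = K) (x : HiggsLattice.Site P k) :
    x ∈ (T.lam k)ᶜ ∨ (∃ j, j < n ∧ x ∈ ann T k j) ∨ x ∈ core T k n := by
  by_cases h0 : x ∈ T.lam k
  · right
    by_cases hn : lamUp T k n x
    · exact Or.inr ((mem_core_iff T k n x).mpr hn)
    · left
      obtain ⟨j, hj, hpj, hpj'⟩ :=
        Tower.exists_descent (p := fun j => lamUp T k j x) n ((lamUp_zero T k x).mpr h0) hn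
      exact ⟨j, hj, (mem_ann_iff T (by omega) x).mpr ⟨hpj, hpj'⟩⟩
  · exact Or.inl (Finset.mem_compl.mpr h0)

/-- **(3.6)** as an identity of finite sets on `T⁽ᵏ⁾`, `k + n + 1 = K`:
`T⁽ᵏ⁾ = Λ₅⁽ᵏ⁾ᶜ ∪ ⋃_{j<n} B^{j+1}(Λ₅⁽ᵏ⁺ʲ⁾′ ∩ Λ₅⁽ᵏ⁺ʲ⁺¹⁾ᶜ) ∪ Bⁿ(Λ₅⁽ᵏ⁺ⁿ⁾)` (`l = k + j + 1` runs over `k+1, …, K−1`,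
`k + n = K − 1`). [cite: Balaban1982Higgs2, (3.6) p.584] -/
theorem eq36 {k n : ℕ} (hK : k + n + 1 = K) :
    (univ : Finset (HiggsLattice.Site P k)) = (T.lam k)ᶜ ∪ (range n).biUnion (ann T k) ∪ core T k n := by
  ext x
  simp only [Finset.mem_univ, Finset.mem_union, Finset.mem_biUnion, Finset.mem_range, true_iff]
  rcases eq36_cover T hK x with h | ⟨j, hj, hx⟩ | h
  · exact Or.inl (Or.inl h)
  · exact Or.inl (Or.inr ⟨j, hj, hx⟩)
  · exact Or.inr h

/-- `Λ₅⁽ᵏ⁾ᶜ` is disjoint from every annulus (an annulus site has `x_k ∈ Λ₅⁽ᵏ⁾` by nesting).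
[cite: Balaban1982Higgs2, (3.6) p.584] -/
theorem disjoint_compl_ann {k n : ℕ} (hK : k + n + 1 = K) {j : ℕ} (hj : j < n) :
    Disjoint (T.lam k)ᶜ (ann T k j) := by
  rw [Finset.disjoint_left]
  intro x hx hx'
  have h := ((mem_ann_iff T (by omega) x).mp hx').1
  exact Finset.mem_compl.mp hx ((lamUp_zero T k x).mp (lamUp_anti T (Nat.zero_le j) (by omega) x h))

/-- `Λ₅⁽ᵏ⁾ᶜ` is disjoint from the core. [cite: Balaban1982Higgs2, (3.6) p.584] -/
theorem disjoint_compl_core {k n : ℕ} (hK : k + n + 1 = K) : Disjoint (T.lam k)ᶜ (core T k n) := by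
  rw [Finset.disjoint_left]
  intro x hx hx'
  have h := (mem_core_iff T k n x).mp hx'
  exact Finset.mem_compl.mp hx ((lamUp_zero T k x).mp (lamUp_anti T (Nat.zero_le n) (by omega) x h))

/-- Two different annuli are disjoint. [cite: Balaban1982Higgs2, (3.6) p.584] -/
theorem disjoint_ann_ann {k n : ℕ} (hK : k + n + 1 = K) {j j' : ℕ} (hj : j < n) (hj' : j' < n) (hne : j ≠ j') :
    Disjoint (ann T k j) (ann T k j') := by
  wlog hlt : j < j' generalizing j j'
  · exact (this hj' hj hne.symm (lt_of_le_of_ne (not_lt.mp hlt) hne.symm)).symm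
  rw [Finset.disjoint_left]
  intro x hx hx'
  have h1 := (mem_ann_iff T (by omega) x).mp hx
  have h2 := (mem_ann_iff T (by omega) x).mp hx'
  exact h1.2 (lamUp_anti T (Nat.succ_le_of_lt hlt) (by omega) x h2.1)

/-- Every annulus is disjoint from the core. [cite: Balaban1982Higgs2, (3.6) p.584] -/
theorem disjoint_ann_core {k n : ℕ} (hK : k + n + 1 = K) {j : ℕ} (hj : j < n) :
    Disjoint (ann T k j) (core T k n) := by
  rw [Finset.disjoint_left]
  intro x hx hx'
  have h1 := (mem_ann_iff T (by omega) x).mp hx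
  have h2 := (mem_core_iff T k n x).mp hx'
  exact h1.2 (lamUp_anti T (Nat.succ_le_of_lt hj) (by omega) x h2)

/-- The annuli form a pairwise disjoint family on `{j < n}`. [cite: Balaban1982Higgs2, (3.6) p.584] -/
theorem pairwiseDisjoint_ann {k n : ℕ} (hK : k + n + 1 = K) :
    ((range n : Finset ℕ) : Set ℕ).PairwiseDisjoint (ann T k) := by
  intro j hj j' hj' hne
  exact disjoint_ann_ann T hK (Finset.mem_range.mp hj) (Finset.mem_range.mp hj') hne

/-- **(3.6) counted**: `|T⁽ᵏ⁾| = |Λ₅⁽ᵏ⁾ᶜ| + Σ_{j<n} |B^{j+1}(Λ₅⁽ᵏ⁺ʲ⁾′ ∩ Λ₅⁽ᵏ⁺ʲ⁺¹⁾ᶜ)| + |Bⁿ(Λ₅⁽ᵏ⁺ⁿ⁾)|` (the union is a "sum").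
[cite: Balaban1982Higgs2, (3.6) p.584] -/
theorem card_eq36 {k n : ℕ} (hK : k + n + 1 = K) :
    Fintype.card (HiggsLattice.Site P k)
      = (T.lam k)ᶜ.card + ∑ j ∈ range n, (ann T k j).card + (core T k n).card := by
  rw [← Finset.card_univ, eq36 T hK]
  have hd1 : Disjoint ((T.lam k)ᶜ ∪ (range n).biUnion (ann T k)) (core T k n) := by
    rw [Finset.disjoint_union_left]
    refine ⟨disjoint_compl_core T hK, ?_⟩
    rw [Finset.disjoint_biUnion_left]
    exact fun j hj => disjoint_ann_core T hK (Finset.mem_range.mp hj)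
  have hd2 : Disjoint (T.lam k)ᶜ ((range n).biUnion (ann T k)) := by
    rw [Finset.disjoint_biUnion_right]
    exact fun j hj => disjoint_compl_ann T hK (Finset.mem_range.mp hj)
  rw [Finset.card_union_of_disjoint hd1, Finset.card_union_of_disjoint hd2,
    Finset.card_biUnion (pairwiseDisjoint_ann T hK)]


end Literature.MathematicalPhysics.QuantumFieldTheory.Balaban1983to89.B2Eq36ScaleDecomposition
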